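/-
Copyright (c) 2026 the pub-hodgecm-mathlib formalisation cell (harness21).  Prover seat hodgecm-mathlib-K2E1-p09 (g4), Track B ∕ K2-LIT,
h413 = `stmt-HodgeConjecture-24833`, line `K2_E1_TraceFormulaBeta`, campaign RES-RANK-ONE, page «EIS-RANK-ONE»: DEAL «EIS-R4a REGULARITY KIT» of the dealer
K2E1-plan (g3) 2026-09-04T04:32:53Z.
-/
import Mathlib.Analysis.Normed.Group.FunctionSeries
import Mathlib.Analysis.Complex.LocallyUniformLimit
import HarnessLib

/-!
# h413 ∕ Track B «K2-LIT», page EIS-RANK-ONE — `K2E1EisensteinSeriesRegularity`: the REGULARITY KIT for series `Σ'_q F_q` under a LOCALLY UNIFORM SUMMABLE MAJORANT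
# (continuity, joint continuity, holomorphy in the parameter, moderate-growth transfer) — index-agnostic, def-free

Cell `pub/hodgecm-mathlib`, crux H413 = `stmt-HodgeConjecture-24833`, route `HCCMUnconditional`; dealer K2E1-plan (g3) (ruling R-EIS-1, campaign page
`CAMPAIGN-EIS-RANK-ONE`).  THEOREMS ONLY over Mathlib (no `def`, no `instance`, no `notation`, no named-fact hypothesis, no `sorry`); lane
`--kind proof --supports stmt-HodgeConjecture-24833 --as helper` (count-neutral).

THE HYPOTHESIS SHAPE is rung R2's output (Godement's majorant): a **locally uniform summable majorant**
  `hmaj : ∀ x₀, ∃ U ∈ 𝓝 x₀, ∃ u : Q → ℝ, Summable u ∧ ∀ x ∈ U, ∀ q, ‖F q x‖ ≤ u q`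
for an ARBITRARY family `F : Q → X → E` (`Q` any index type, `X` a topological space, `E` a complete normed group).  The Eisenstein shape `F q g = f (ρ q * g)`
(`ρ : Q → G` the representatives — p08's `eisensteinSeriesU` in the LEFT convention, or `f (g * ρ q)` for the right-convention `E_φ` of ★ p857309) is an instance by `rfl`.
* §1 **`continuous_tsum_of_locallyUniformMajorant`** — termwise continuity ⟹ `x ↦ Σ'_q F q x` continuous (Mathlib `continuousOn_tsum` on each `U`, glued on the open cover);
  JOINT continuity in `(z, g)` is the same lemma at `X := ℂ × G`; translate forms `continuous_tsum_translate_left ∕ _right`.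
* §2 **`differentiableOn_tsum_of_locallyUniformMajorant`** — `D ⊆ ℂ` open, termwise `DifferentiableOn ℂ (F q) D`, majorants on neighbourhoods inside `D` ⟹
  `DifferentiableOn ℂ (Σ'_q F q) D` (Mathlib `differentiableOn_tsum_of_summable_norm` locally); the parametrised form `differentiableOn_tsum_param` (`F q z x`, each `x`).
* §3 **`norm_tsum_le_mul_of_majorant`** — the MODERATE-GROWTH transfer: `‖F q x‖ ≤ C · u₀ q` (all `q`), `Summable u₀`, `Σ' u₀ ≤ B`, `0 ≤ C` ⟹ `‖Σ'_q F q x‖ ≤ C · B` (and the family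
  is summable) — the shape «`‖E(z, g)‖ ≤ C · H(g)^{Re z}` on Siegel sets» that R4 assembles.
[MW1995 II.1.5 Prop.; Garrett2018 §2.8; tree twins for K2Liu: ★ `K2LiuMajorantLocallyBounded`, ★ `K2LiuContinuedPairingHolomorphic` — patterns, not imported.]

HONEST LABEL.  Count-neutral helper; proves no printed statement; HC_CM is proved only modulo the 7 printed citations (2 remaining named inputs: hLiu418 =
`stmt-HodgeConjecture-24832`, h413 = `stmt-HodgeConjecture-24833`) until rung 0 closes.

## References
* [MoeglinWaldspurger1995] C. Mœglin, J.-L. Waldspurger, *Spectral decomposition and Eisenstein series* (1995), II.1.5 (convergence and holomorphy of Eisenstein series).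
* [Garrett2018] P. Garrett, *Modern Analysis of Automorphic Forms by Example* 1 (2018), §2.8.
-/

set_option autoImplicit false
set_option linter.dupNamespace false  -- the mandated namespace repeats the summit's segment (`HodgeConjecture.HodgeConjecture`)

noncomputable section
open Set Filter Topology
open scoped NNReal

namespace Summit.HodgeConjecture.HodgeConjecture.Cruxes.H413.K2E1EisensteinSeriesRegularity

/-! ## §1 Continuity -/

section Continuity

variable {Q X E : Type*} [TopologicalSpace X] [NormedAddCommGroup E] [CompleteSpace E]

/-- **A SERIES WITH A LOCALLY UNIFORM SUMMABLE MAJORANT IS CONTINUOUS** if its terms are: for `F : Q → X → E` with every `F q` continuous and, near every point, a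
summable `u` with `‖F q x‖ ≤ u q`, the function `x ↦ Σ'_q F q x` is continuous (Weierstrass M-test on each neighbourhood, Mathlib `continuousOn_tsum`).  Joint continuity in a
parameter is the case `X := ℂ × G`. [cite: MoeglinWaldspurger1995, II.1.5] [cite: Garrett2018, §2.8] -/
theorem continuous_tsum_of_locallyUniformMajorant {F : Q → X → E} (hF : ∀ q, Continuous (F q))
    (hmaj : ∀ x₀ : X, ∃ U ∈ 𝓝 x₀, ∃ u : Q → ℝ, Summable u ∧ ∀ x ∈ U, ∀ q, ‖F q x‖ ≤ u q) :
    Continuous fun x => ∑' q, F q x := by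
  refine continuous_iff_continuousAt.2 fun x₀ => ?_
  obtain ⟨U, hU, u, hu, hle⟩ := hmaj x₀
  have hon : ContinuousOn (fun x => ∑' q, F q x) U := continuousOn_tsum (fun q => (hF q).continuousOn) hu fun q x hx => hle x hx q
  exact hon.continuousAt hU

/-- The family is summable at every point (comparison with the local majorant). [folklore] -/
theorem summable_of_locallyUniformMajorant {F : Q → X → E}
    (hmaj : ∀ x₀ : X, ∃ U ∈ 𝓝 x₀, ∃ u : Q → ℝ, Summable u ∧ ∀ x ∈ U, ∀ q, ‖F q x‖ ≤ u q) (x : X) :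
    Summable fun q => F q x := by
  obtain ⟨U, hU, u, hu, hle⟩ := hmaj x
  exact Summable.of_norm_bounded hu fun q => hle x (mem_of_mem_nhds hU) q

variable {G : Type*} [TopologicalSpace G] [Mul G] [ContinuousMul G]

/-- **LEFT-translate form** (p08's `eisensteinSeriesU f g = Σ'_q f (ρ q * g)`): `f` continuous and a locally uniform summable majorant for `g ↦ f (ρ q * g)` ⟹
`g ↦ Σ'_q f (ρ q * g)` continuous. [cite: MoeglinWaldspurger1995, II.1.5] -/
theorem continuous_tsum_translate_left {ρ : Q → G} {f : G → E} (hf : Continuous f)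
    (hmaj : ∀ g₀ : G, ∃ U ∈ 𝓝 g₀, ∃ u : Q → ℝ, Summable u ∧ ∀ g ∈ U, ∀ q, ‖f (ρ q * g)‖ ≤ u q) :
    Continuous fun g => ∑' q, f (ρ q * g) :=
  continuous_tsum_of_locallyUniformMajorant (F := fun q g => f (ρ q * g)) (fun _ => hf.comp (continuous_const.mul continuous_id)) hmaj

/-- **RIGHT-translate form** (the tree's `E_φ(g) = Σ'_q φ (g q̃)`, ★ p857309): the same with `f (g * ρ q)`. [cite: MoeglinWaldspurger1995, II.1.5] -/
theorem continuous_tsum_translate_right {ρ : Q → G} {f : G → E} (hf : Continuous f)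
    (hmaj : ∀ g₀ : G, ∃ U ∈ 𝓝 g₀, ∃ u : Q → ℝ, Summable u ∧ ∀ g ∈ U, ∀ q, ‖f (g * ρ q)‖ ≤ u q) :
    Continuous fun g => ∑' q, f (g * ρ q) :=
  continuous_tsum_of_locallyUniformMajorant (F := fun q g => f (g * ρ q)) (fun _ => hf.comp (continuous_id.mul continuous_const)) hmaj

/-- **JOINT CONTINUITY in `(z, g)`** for a parametrised left-translate series `Σ'_q f z (ρ q * g)`: `f` jointly continuous on `ℂ × G` and a majorant locally uniform in `(z, g)`.
[cite: MoeglinWaldspurger1995, II.1.5] -/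
theorem continuous_tsum_translate_uncurry {ρ : Q → G} {f : ℂ → G → E} (hf : Continuous fun p : ℂ × G => f p.1 p.2)
    (hmaj : ∀ p₀ : ℂ × G, ∃ U ∈ 𝓝 p₀, ∃ u : Q → ℝ, Summable u ∧ ∀ p ∈ U, ∀ q, ‖f p.1 (ρ q * p.2)‖ ≤ u q) :
    Continuous fun p : ℂ × G => ∑' q, f p.1 (ρ q * p.2) :=
  continuous_tsum_of_locallyUniformMajorant (F := fun q (p : ℂ × G) => f p.1 (ρ q * p.2))
    (fun _ => hf.comp (continuous_fst.prodMk (continuous_const.mul continuous_snd))) hmaj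

end Continuity

/-! ## §2 Holomorphy in the parameter -/

section Holomorphy

variable {Q E : Type*} [NormedAddCommGroup E] [NormedSpace ℂ E] [CompleteSpace E]

/-- **A SERIES OF HOLOMORPHIC FUNCTIONS WITH LOCALLY UNIFORM SUMMABLE MAJORANTS IS HOLOMORPHIC**: `D` open, every `F q` differentiable on `D`, and for every `z₀ ∈ D` a
neighbourhood `D' ⊆ D` with a summable `u`, `‖F q z‖ ≤ u q` on `D'` ⟹ `z ↦ Σ'_q F q z` is differentiable on `D` (Mathlib `differentiableOn_tsum_of_summable_norm` on an open
neighbourhood inside `D'`, then `DifferentiableAt`). [cite: MoeglinWaldspurger1995, II.1.5] [cite: Garrett2018, §2.8] -/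
theorem differentiableOn_tsum_of_locallyUniformMajorant {F : Q → ℂ → E} {D : Set ℂ} (hD : IsOpen D) (hF : ∀ q, DifferentiableOn ℂ (F q) D)
    (hmaj : ∀ z₀ ∈ D, ∃ D' ∈ 𝓝 z₀, ∃ u : Q → ℝ, Summable u ∧ ∀ z ∈ D', ∀ q, ‖F q z‖ ≤ u q) :
    DifferentiableOn ℂ (fun z => ∑' q, F q z) D := by
  intro z₀ hz₀
  obtain ⟨D', hD', u, hu, hle⟩ := hmaj z₀ hz₀
  -- an open neighbourhood of `z₀` inside `D ∩ D'`
  obtain ⟨V, hVsub, hVopen, hzV⟩ := mem_nhds_iff.1 (inter_mem (hD.mem_nhds hz₀) hD')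
  have hdiff : DifferentiableOn ℂ (fun z => ∑' q, F q z) V :=
    Complex.differentiableOn_tsum_of_summable_norm hu (fun q => (hF q).mono fun z hz => (hVsub hz).1) hVopen fun q z hz => hle z (hVsub hz).2 q
  exact (hdiff.differentiableAt (hVopen.mem_nhds hzV)).differentiableWithinAt

/-- **PARAMETRISED FORM** (each `x` separately): `F q z x` holomorphic in `z ∈ D` for every `q`, with majorants locally uniform in `z` (they may depend on `x`) ⟹
`z ↦ Σ'_q F q z x` holomorphic on `D` — the shape «`E(f_z, g)` is holomorphic in `z` on the Godement half-plane for each `g`». [cite: MoeglinWaldspurger1995, II.1.5] -/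
theorem differentiableOn_tsum_param {X : Type*} {F : Q → ℂ → X → E} {D : Set ℂ} (hD : IsOpen D) (x : X) (hF : ∀ q, DifferentiableOn ℂ (fun z => F q z x) D)
    (hmaj : ∀ z₀ ∈ D, ∃ D' ∈ 𝓝 z₀, ∃ u : Q → ℝ, Summable u ∧ ∀ z ∈ D', ∀ q, ‖F q z x‖ ≤ u q) :
    DifferentiableOn ℂ (fun z => ∑' q, F q z x) D :=
  differentiableOn_tsum_of_locallyUniformMajorant (F := fun q z => F q z x) hD hF hmaj

end Holomorphy

/-! ## §3 The moderate-growth transfer -/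

section Growth

variable {Q E : Type*} [NormedAddCommGroup E] [CompleteSpace E]

omit [CompleteSpace E] in
/-- **MODERATE GROWTH TRANSFERS FROM THE MAJORANT TO THE SUM**: if `‖F q‖ ≤ C · u₀ q` for all `q` with `u₀` summable, `Σ' u₀ ≤ B` and `0 ≤ C`, then `‖Σ'_q F q‖ ≤ C · B` — the
shape «`‖E(z, g)‖ ≤ C(K) · H(g)^{Re z}` on Siegel sets» (take `C = C(K) H(g)^{Re z}`). [cite: MoeglinWaldspurger1995, II.1.5] [cite: Garrett2018, §2.8] -/
theorem norm_tsum_le_mul_of_majorant {F : Q → E} {u₀ : Q → ℝ} {C B : ℝ} (hC : 0 ≤ C) (hu₀ : Summable u₀) (hB : ∑' q, u₀ q ≤ B)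
    (hle : ∀ q, ‖F q‖ ≤ C * u₀ q) : ‖∑' q, F q‖ ≤ C * B := by
  have h1 : ‖∑' q, F q‖ ≤ ∑' q, C * u₀ q := tsum_of_norm_bounded (hu₀.mul_left C).hasSum hle
  rw [tsum_mul_left] at h1
  exact h1.trans (mul_le_mul_of_nonneg_left hB hC)

/-- … and the family is summable. [folklore] -/
theorem summable_of_majorant_mul {F : Q → E} {u₀ : Q → ℝ} {C : ℝ} (hu₀ : Summable u₀) (hle : ∀ q, ‖F q‖ ≤ C * u₀ q) : Summable F :=
  Summable.of_norm_bounded (hu₀.mul_left C) hle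

omit [CompleteSpace E] in
/-- **THE SAME FOR A FAMILY OF POINTS**: a majorant `‖F q x‖ ≤ c x · u₀ q` uniform on a set `S` gives `‖Σ'_q F q x‖ ≤ c x · Σ' u₀` on `S` (e.g. `c g = C(K)·H(g)^{Re z}` on a
Siegel set). [cite: MoeglinWaldspurger1995, II.1.5] -/
theorem norm_tsum_le_mul_tsum_of_majorant_on {X : Type*} {F : Q → X → E} {u₀ : Q → ℝ} {c : X → ℝ} {S : Set X} (hu₀ : Summable u₀)
    (hc : ∀ x ∈ S, 0 ≤ c x) (hle : ∀ x ∈ S, ∀ q, ‖F q x‖ ≤ c x * u₀ q) {x : X} (hx : x ∈ S) :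
    ‖∑' q, F q x‖ ≤ c x * ∑' q, u₀ q :=
  norm_tsum_le_mul_of_majorant (hc x hx) hu₀ le_rfl (hle x hx)

end Growth

end Summit.HodgeConjecture.HodgeConjecture.Cruxes.H413.K2E1EisensteinSeriesRegularity

end
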